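import Summits.BirchSwinnertonDyer.BirchSwinnertonDyer.Theorems.CyclotomicUntwistPSUntwistedTraceDefs
import Mathlib.AlgebraicGeometry.EllipticCurve.VariableChange
import Summits.BirchSwinnertonDyer.Rank1Residual.GaloisImage.HauptmodulThreeQuarticValuation
import HarnessLib

/-!
# LAW L-a3: `a_w` is an invariant of the CURVE — `psUntwistedTrace` does not depend on the Weierstrass equation
# (route `CyclotomicUntwist`, cruxes K1 `PSRankOneLowerHalfAtThree` / K2 `PSRankOneUpperHalfAtThree`)

Cell `pub/bsd-wall` (D-0145 line `route-BirchSwinnertonDyer-CyclotomicUntwist`), seat `bsd-line-cycu-p3` (gen 6).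
Helper toward K1 (stmt-BirchSwinnertonDyer-21580) / K2 (stmt-21581). THEOREMS ONLY (no definition, no named fact,
no `sorry`); BSD is not proved by this file and no crux is.

The Defs file `CyclotomicUntwistPSUntwistedTraceDefs` (p616806) defines `W.psUntwistedTrace` from the invariants
`c₆, Δ` of the equation `W` and SAYS «any equation of the curve may be used: a rescaling `u = 3ᵏu₀` shifts `v₃Δ` by `12k`
and multiplies `c₆', Δ′` by `u₀⁻⁶ ≡ u₀⁻¹² ≡ 1 (mod 9)`». This file PROVES it:
**`psUntwistedTrace_variableChange : (C • W).psUntwistedTrace = W.psUntwistedTrace`** for every `C : VariableChange ℚ`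
and every `W` with `Δ ≠ 0` (`c₆(C • W) = u⁻⁶c₆`, `Δ(C • W) = u⁻¹²Δ`, Silverman III Table 3.1). Ingredients, all about
Rizzo's residue currency `Rizzo.res9` / `Rizzo.primeToThreePart` of `RootNumberTableThree` (and reusable for the
equation-independence of the Table II readings, which that file asserts in prose):

* `res9_cast` — in `ℤ/9`, `res9 x = num(x′)·den(x′)⁻¹` for the prime-to-`3` part `x′` (both branches of the definition);
  `res9_mem_Ico` (`0 ≤ res9 x < 9`), `res9_eq_of_cast_eq`;
* `padicValRat_primeToThreePart` (with b2b's `GaloisImage.not_dvd_num_den_of_padicValRat_eq_zero`), `primeToThreePart_ne_zero`,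
  `primeToThreePart_mul`, `primeToThreePart_pow`;
* `natCast_mul_inv_eq_one`, **`cast_num_mul_inv_den_eq_of_eq_div`** — if `q = m / n` in `ℚ` with `3 ∤ n` then
  `num(q)·den(q)⁻¹ = m·n⁻¹` in `ℤ/9` (the residue is read off ANY `3`-integral quotient representation);
* `pow_six_eq_one_of_ne`, `intCast_pow_six_eq_one`, `natCast_pow_six_eq_one` (`x⁶ = 1` for units of `ℤ/9`);
* **`res9_pow_six_mul`**: `res9 (u⁶·x) = res9 x` and **`res9_pow_twelve_mul`**: `res9 (u¹²·x) = res9 x` (`u ≠ 0`);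
  `padicValRat_pow_twelve_mul_emod` (`v₃(u¹²x) ≡ v₃(x) (mod 12)`, `u, x ≠ 0`);
* **`untwistedTraceOfInvariants_rescale`**, **`psUntwistedTrace_variableChange`** (`Δ ≠ 0`),
  `psUntwistedTrace_variableChange_of_isElliptic`.

References: O. G. Rizzo, Compositio Math. 136 (2003) §1.1–1.2 [Rizzo2003]; J. H. Silverman, *AEC* III.1 Table 3.1 [SilvermanAEC2009].
-/

set_option autoImplicit false
-- single-conjunct summit: `Summit.BirchSwinnertonDyer.BirchSwinnertonDyer.…` repeats the name by design
set_option linter.dupNamespace false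

open Literature.NumberTheory.EllipticCurves Summit.BirchSwinnertonDyer.Rank1Residual.GaloisImage

namespace Summit.BirchSwinnertonDyer.BirchSwinnertonDyer.Theorems.PSUntwistedTrace

/-! ### Rizzo's residue `res9` as an element of `ℤ/9` -/

section Res9

/-- `((a % 9 : ℤ) : ℤ/9) = a`. [folklore] -/
theorem intCast_emod_nine (a : ℤ) : ((a % 9 : ℤ) : ZMod 9) = (a : ZMod 9) := by
  rw [ZMod.intCast_eq_intCast_iff']
  push_cast
  exact Int.emod_emod_of_dvd a (dvd_refl 9)

/-- **`res9` in `ℤ/9`**: for every `x : ℚ`, `(res9 x : ℤ/9) = num(x′) · den(x′)⁻¹` with `x′ = primeToThreePart x` (both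
branches of the definition agree with this). [cite: Rizzo2003, p. 2 (notation x')] -/
theorem res9_cast (x : ℚ) :
    ((Rizzo.res9 x : ℤ) : ZMod 9) =
      ((Rizzo.primeToThreePart x).num : ZMod 9) * (((Rizzo.primeToThreePart x).den : ZMod 9))⁻¹ := by
  unfold Rizzo.res9
  split_ifs with h
  · rw [h, intCast_emod_nine]; push_cast; simp
  · push_cast
    rw [ZMod.natCast_zmod_val]

/-- `0 ≤ res9 x < 9`. [folklore] -/
theorem res9_mem_Ico (x : ℚ) : 0 ≤ Rizzo.res9 x ∧ Rizzo.res9 x < 9 := by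
  unfold Rizzo.res9
  split_ifs with h
  · exact ⟨Int.emod_nonneg _ (by norm_num), Int.emod_lt_of_pos _ (by norm_num)⟩
  · refine ⟨by positivity, ?_⟩
    exact_mod_cast ZMod.val_lt _

/-- `res9` is determined by its image in `ℤ/9`. [folklore] -/
theorem res9_eq_of_cast_eq {x y : ℚ} (h : ((Rizzo.res9 x : ℤ) : ZMod 9) = ((Rizzo.res9 y : ℤ) : ZMod 9)) :
    Rizzo.res9 x = Rizzo.res9 y := by
  have hx := res9_mem_Ico x
  have hy := res9_mem_Ico y
  have := (ZMod.intCast_eq_intCast_iff _ _ 9).mp h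
  unfold Int.ModEq at this
  omega

/-- The prime-to-`3` part of a non-zero rational has valuation `0`. [cite: Rizzo2003, p. 2 (notation x')] -/
theorem padicValRat_primeToThreePart {x : ℚ} (hx : x ≠ 0) : padicValRat 3 (Rizzo.primeToThreePart x) = 0 := by
  unfold Rizzo.primeToThreePart
  have h3 : (3 : ℚ) ^ padicValRat 3 x ≠ 0 := zpow_ne_zero _ (by norm_num)
  have h33 : padicValRat 3 (3 : ℚ) = 1 := by
    have := @padicValRat.self 3 (by norm_num)
    simpa using this
  rw [div_eq_mul_inv, padicValRat.mul hx (inv_ne_zero h3), padicValRat.inv, padicValRat.zpow, h33]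
  ring

/-- The prime-to-`3` part is non-zero for `x ≠ 0`. [folklore] -/
theorem primeToThreePart_ne_zero {x : ℚ} (hx : x ≠ 0) : Rizzo.primeToThreePart x ≠ 0 := by
  unfold Rizzo.primeToThreePart
  exact div_ne_zero hx (zpow_ne_zero _ (by norm_num))

/-- The prime-to-`3` part is multiplicative on non-zero rationals. [cite: Rizzo2003, p. 2 (notation x')] -/
theorem primeToThreePart_mul {x y : ℚ} (hx : x ≠ 0) (hy : y ≠ 0) :
    Rizzo.primeToThreePart (x * y) = Rizzo.primeToThreePart x * Rizzo.primeToThreePart y := by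
  unfold Rizzo.primeToThreePart
  rw [padicValRat.mul hx hy, zpow_add₀ (by norm_num : (3 : ℚ) ≠ 0)]
  field_simp

/-- The prime-to-`3` part of a power. [folklore] -/
theorem primeToThreePart_pow {x : ℚ} (hx : x ≠ 0) (n : ℕ) :
    Rizzo.primeToThreePart (x ^ n) = Rizzo.primeToThreePart x ^ n := by
  induction n with
  | zero => simp [Rizzo.primeToThreePart]
  | succ n ih => rw [pow_succ, primeToThreePart_mul (pow_ne_zero _ hx) hx, ih, pow_succ]

/-- `n · n⁻¹ = 1` in `ℤ/9` for `3 ∤ n`. [folklore] -/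
theorem natCast_mul_inv_eq_one {n : ℕ} (hn : ¬ 3 ∣ n) : (n : ZMod 9) * ((n : ZMod 9))⁻¹ = 1 :=
  ZMod.coe_mul_inv_eq_one n
    (Nat.Coprime.pow_right 2 ((Nat.Prime.coprime_iff_not_dvd Nat.prime_three).mpr hn).symm)

/-- **The `ℤ/9`-residue of a `3`-integral rational from ANY quotient representation**: if `q = m / n` in `ℚ` with
`n : ℕ`, `3 ∤ n`, then `num(q)·den(q)⁻¹ = m·n⁻¹` in `ℤ/9` (and `3 ∤ den(q)`). [folklore] -/
theorem cast_num_mul_inv_den_eq_of_eq_div {q : ℚ} {m : ℤ} {n : ℕ} (hn : ¬ 3 ∣ n) (h : q = (m : ℚ) / n) :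
    (q.num : ZMod 9) * ((q.den : ZMod 9))⁻¹ = (m : ZMod 9) * ((n : ZMod 9))⁻¹ := by
  have hnz : n ≠ 0 := fun h0 ↦ hn (h0 ▸ dvd_zero 3)
  have hn0 : (n : ℚ) ≠ 0 := by exact_mod_cast hnz
  have hq : (q.num : ℚ) / q.den = (m : ℚ) / n := by rw [Rat.num_div_den]; exact h
  have hden0 : (q.den : ℚ) ≠ 0 := by exact_mod_cast q.den_nz
  have hZ : q.num * n = m * q.den := by
    have := (div_eq_div_iff hden0 hn0).mp hq
    exact_mod_cast this
  -- `3 ∤ q.den`: from `q.num * n = m * q.den` and coprimality of `q.num`, `q.den`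
  have hdq : ¬ 3 ∣ q.den := by
    intro hd
    have h3 : (3 : ℤ) ∣ q.num * n := hZ ▸ dvd_mul_of_dvd_right (by exact_mod_cast hd) m
    rcases Int.prime_three.dvd_or_dvd h3 with h | h
    · have hg : 3 ∣ Nat.gcd q.num.natAbs q.den :=
        Nat.dvd_gcd (by exact_mod_cast Int.natAbs_dvd_natAbs.mpr h) hd
      rw [q.reduced] at hg
      omega
    · exact hn (by exact_mod_cast h)
  have h1 := natCast_mul_inv_eq_one hn
  have h2 := natCast_mul_inv_eq_one hdq
  have hZ' : (q.num : ZMod 9) * (n : ZMod 9) = (m : ZMod 9) * (q.den : ZMod 9) := by exact_mod_cast congrArg (Int.cast : ℤ → ZMod 9) hZ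
  linear_combination (((q.den : ZMod 9))⁻¹ * ((n : ZMod 9))⁻¹) * hZ' - (q.num : ZMod 9) * ((q.den : ZMod 9))⁻¹ * h1
    + (m : ZMod 9) * ((n : ZMod 9))⁻¹ * h2

/-- Sixth powers of units of `ℤ/9` are `1` (the unit group is cyclic of order `6`). [folklore] -/
theorem pow_six_eq_one_of_ne : ∀ z : ZMod 9, ZMod.castHom (show 3 ∣ 9 by norm_num) (ZMod 3) z ≠ 0 → z ^ 6 = 1 := by
  decide

/-- `m⁶ = 1` in `ℤ/9` for an integer `m` prime to `3`. [folklore] -/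
theorem intCast_pow_six_eq_one {m : ℤ} (hm : ¬ (3 : ℤ) ∣ m) : (m : ZMod 9) ^ 6 = 1 := by
  refine pow_six_eq_one_of_ne _ ?_
  rw [map_intCast, Ne, ZMod.intCast_zmod_eq_zero_iff_dvd]; exact_mod_cast hm

/-- `n⁶ = 1` in `ℤ/9` for a natural number `n` prime to `3`. [folklore] -/
theorem natCast_pow_six_eq_one {n : ℕ} (hn : ¬ 3 ∣ n) : (n : ZMod 9) ^ 6 = 1 := by
  refine pow_six_eq_one_of_ne _ ?_
  rw [map_natCast, Ne, ZMod.natCast_eq_zero_iff]; exact_mod_cast hn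

end Res9

/-! ### `res9` and `v₃ mod 12` are invariant under `(c₆, Δ) ↦ (u⁶c₆, u¹²Δ)` -/

section Rescale

/-- A rational as the quotient of its numerator and denominator, for products with a sixth power:
`P⁶·Q = (num P⁶ · num Q) / (den P⁶ · den Q)`. [folklore] -/
theorem pow_six_mul_eq_div (P Q : ℚ) :
    P ^ 6 * Q = (((P.num ^ 6 * Q.num : ℤ)) : ℚ) / (((P.den ^ 6 * Q.den : ℕ)) : ℚ) := by
  have hP : (P.den : ℚ) ≠ 0 := by exact_mod_cast P.den_nz
  have hQ : (Q.den : ℚ) ≠ 0 := by exact_mod_cast Q.den_nz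
  conv_lhs => rw [← Rat.num_div_den P, ← Rat.num_div_den Q]
  push_cast
  field_simp

/-- **`res9 (u⁶·x) = res9 x`** for `u ≠ 0`: the prime-to-`3` part gets multiplied by `(u′)⁶`, whose image in `ℤ/9` is
a sixth power of a unit, i.e. `1`. [cite: Rizzo2003, §1.2 (any equation)] -/
theorem res9_pow_six_mul {u : ℚ} (hu : u ≠ 0) (x : ℚ) : Rizzo.res9 (u ^ 6 * x) = Rizzo.res9 x := by
  by_cases hx : x = 0
  · subst hx; simp
  refine res9_eq_of_cast_eq ?_
  rw [res9_cast, res9_cast]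
  set P := Rizzo.primeToThreePart u with hPdef
  set Q := Rizzo.primeToThreePart x with hQdef
  have hP0 : P ≠ 0 := primeToThreePart_ne_zero hu
  have hQ0 : Q ≠ 0 := primeToThreePart_ne_zero hx
  obtain ⟨hPn, hPd⟩ := not_dvd_num_den_of_padicValRat_eq_zero hP0 (padicValRat_primeToThreePart hu)
  obtain ⟨-, hQd⟩ := not_dvd_num_den_of_padicValRat_eq_zero hQ0 (padicValRat_primeToThreePart hx)
  have hR : Rizzo.primeToThreePart (u ^ 6 * x) = P ^ 6 * Q := by
    rw [primeToThreePart_mul (pow_ne_zero _ hu) hx, primeToThreePart_pow hu]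
  have hn : ¬ 3 ∣ P.den ^ 6 * Q.den := by
    intro h
    rcases (Nat.Prime.dvd_mul Nat.prime_three).mp h with h | h
    · exact hPd (Nat.prime_three.dvd_of_dvd_pow h)
    · exact hQd h
  have key := cast_num_mul_inv_den_eq_of_eq_div hn (hR.trans (pow_six_mul_eq_div P Q))
  rw [key]
  push_cast
  rw [intCast_pow_six_eq_one hPn, natCast_pow_six_eq_one hPd, one_mul, one_mul]

/-- **`res9 (u¹²·x) = res9 x`** for `u ≠ 0` (`u¹² = (u²)⁶`). [cite: Rizzo2003, §1.2 (any equation)] -/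
theorem res9_pow_twelve_mul {u : ℚ} (hu : u ≠ 0) (x : ℚ) : Rizzo.res9 (u ^ 12 * x) = Rizzo.res9 x := by
  rw [show u ^ 12 = (u ^ 2) ^ 6 by ring]
  exact res9_pow_six_mul (pow_ne_zero _ hu) x

/-- `v₃(u¹²·x) ≡ v₃(x) (mod 12)` for `u, x ≠ 0`. [folklore] -/
theorem padicValRat_pow_twelve_mul_emod {u x : ℚ} (hu : u ≠ 0) (hx : x ≠ 0) :
    padicValRat 3 (u ^ 12 * x) % 12 = padicValRat 3 x % 12 := by
  rw [padicValRat.mul (pow_ne_zero _ hu) hx, padicValRat.pow]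
  push_cast
  omega

/-- **The closed form (N′) is invariant under `(c₆, Δ) ↦ (u⁶c₆, u¹²Δ)`** (`u ≠ 0`, `Δ ≠ 0`) — a change of Weierstrass
equation with scaling `u`. [cite: Rizzo2003, §1.2 (any equation)] [cite: SilvermanAEC2009, III.1 Table 3.1] -/
theorem untwistedTraceOfInvariants_rescale {u : ℚ} (hu : u ≠ 0) (c₆ : ℚ) {Δ : ℚ} (hΔ : Δ ≠ 0) :
    untwistedTraceOfInvariants (u ^ 6 * c₆) (u ^ 12 * Δ) = untwistedTraceOfInvariants c₆ Δ := by
  unfold untwistedTraceOfInvariants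
  rw [res9_pow_six_mul hu, res9_pow_twelve_mul hu, padicValRat_pow_twelve_mul_emod hu hΔ]

end Rescale

/-! ### `psUntwistedTrace` is an invariant of the curve -/

section Curve

/-- **`a_w` does not depend on the equation**: `(C • W).psUntwistedTrace = W.psUntwistedTrace` for every change of
variables `C` over `ℚ` and every `W` with `Δ ≠ 0` (`c₆(C • W) = u⁻⁶ c₆(W)`, `Δ(C • W) = u⁻¹² Δ(W)`). So the untwisted
trace of the Defs file is an invariant of the elliptic curve `E/ℚ`, as claimed there.
[cite: SilvermanAEC2009, III.1 Table 3.1] [cite: Rizzo2003, §1.2 (any equation)] -/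
theorem psUntwistedTrace_variableChange (C : WeierstrassCurve.VariableChange ℚ) (W : WeierstrassCurve ℚ)
    (hΔ : W.Δ ≠ 0) : (C • W).psUntwistedTrace = W.psUntwistedTrace := by
  rw [psUntwistedTrace_def, psUntwistedTrace_def, WeierstrassCurve.variableChange_c₆,
    WeierstrassCurve.variableChange_Δ]
  exact untwistedTraceOfInvariants_rescale (Units.ne_zero _) W.c₆ hΔ

/-- The elliptic-curve form (`Δ` a unit). [cite: SilvermanAEC2009, III.1 Table 3.1] -/
theorem psUntwistedTrace_variableChange_of_isElliptic (C : WeierstrassCurve.VariableChange ℚ)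
    (W : WeierstrassCurve ℚ) [W.IsElliptic] : (C • W).psUntwistedTrace = W.psUntwistedTrace :=
  psUntwistedTrace_variableChange C W W.isUnit_Δ.ne_zero

end Curve



end Summit.BirchSwinnertonDyer.BirchSwinnertonDyer.Theorems.PSUntwistedTrace
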